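import Literature.MathematicalPhysics.QuantumFieldTheory.BalabanImbrieJaffe1984to88.BIJ88NeumannNoZeroModesTorus
import Literature.MathematicalPhysics.QuantumFieldTheory.BalabanImbrieJaffe1984to88.BIJ88Eq5612W6

/-!
# `BalabanImbrieJaffe1984to88.BIJ88NeumannPropagator227Torus` — T. Bałaban, J. Imbrie, A. Jaffe, *Effective action and cluster
properties of the abelian Higgs model*, Commun. Math. Phys. **114** (1988) 257–315 [BalabanImbrieJaffe1988], Sect. 2 p. 262–263 [PDF 6–7]
and Sect. 5.6 p. 287–288 [PDF 31–32]: **the Neumann propagators `G_k(Ω,u)` of the scalar field CONSTRUCTED ON THE TORUS OF RECORD** — for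
EVERY `U(1)` gauge field `u`, every region `Ω ⊂ T_η` that is a union of `k`-blocks and every `a_k > 0` — with the invertibility behind them
PROVED (no zero modes of the Neumann problem on `Ω`), their algebra (`G·H = 1_Ω = H·G`, support `Ω × Ω`, Hermitian, uniqueness) and the
resolvent identity (5.6.11)/(5.6.12) IN A FIXED REGION as exact identities.

statement-level skeleton of published theorems with citation tags; proofs where landed; nothing here is a claim about the Yang–Mills mass gap

PDF held: `paper:balaban1988-cmp114-bij-abelian-higgs-effective-action` (journal page = PDF page + 256); p. 262–263 [PDF 6–7] read as
images this session (renders `HOME/lit-balaban-p31/renders/original-p006-x2.png`, `original-p007-x2.png`); p. 287–288 [PDF 31–32] as read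
(images) for my gen-10 files `BIJ88Vj5610Operator`/`BIJ88Eq5612W6`; [I] = [BalabanImbrieJaffe1985] (CMP **97**) p. 309 [PDF 11], p. 313
[PDF 15] as quoted in p11's `BIJ85ScalarPropagatorTorusK`.

CITATION HEADER (lean-in-tree rule).  Part of the lit-balaban TYPED SKELETON (HOME `run/shared/lean/pub/lit-balaban/`), PHASE-2 proof
seat p31 gen 15 (unit `lit-balaban-p31-g15`; TAKING line HOME/STATUS.md 2026-08-22T10:49:49Z; free-target protocol G.5-34(d) — the item
*"G_k(□,u) WITH BODY on V1 torus cubes"* recorded as successor item 2 (i) of the owner's `HOME/lit-balaban-r18/C2S14-CLOSURE.md` §5).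
WHAT IS REPRODUCED: rows **C2.Eq2.27** (the Neumann propagators `G_k(□_α,u)` entering (2.27)), **C2.Eq5.6.6-5.6.12** members (5.6.10)–
(5.6.12) (the region propagators `G_j(Ω,·)` and their resolvent identity) of `HOME/lit-balaban-r18/ROWS-C2.md` (owner r18) /
`HOME/lit-balaban-r16/ROWS-C2-part2.md` (owner r16) — as TORUS OBJECTS WITH BODIES (kind «model instance / definitions with bodies +
theorems»; no `Prop`-valued fact introduced), on the no-zero-modes theorem of the companion `BIJ88NeumannNoZeroModesTorus` (this seat,
same gen).

THE PRINTED TEXT (verbatim).  p. 262–263 [PDF 6–7]: *"In the scalar field sector, we have the η-lattice propagators G_k(Ω,u) defined on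
subsets Ω ⊂ T_η with Neumann boundary conditions. To localize the dependence on u, we interpolate in a smooth fashion between operators with
Neumann boundary conditions on small cubes. Let {□_α} be the collection of (1/2L) r(e_{k−1})-cubes that can be built from cubes of size
M = O(1) as in [6]. Define G̃_k(u; x₁,x₂) = Σ_α λ_αG_k(□_α, u; x₁,x₂) (2.27) as a convex combination of Neumann propagators."*  p. 287
[PDF 31]: *"For the basic quadratic form with Neumann boundary conditions on Ω giving rise to G_j(Ω), we have −Δ^N_{ũ_{k+1}ũ,Ω} + a_jP_j(ũ_{k+1}ũ)
= −Δ^N_{ũ_{k+1},Ω} + a_jP_j(ũ_{k+1}) − V_j(Ω), (5.6.10) where V_j(Ω) is obtained by inserting (5.6.8), (5.6.9) into the left-hand side. This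
leads to an expansion of the scalar field propagator in a fixed region Ω: G_j(Ω, ũ_{k+1}ũ) = G_j(Ω, ũ_{k+1}) + G_j(Ω, ũ_{k+1})V_jG_j(Ω, ũ_{k+1}ũ).
(5.6.11)"*.  [I] p. 313 [PDF 15]: *"G_k(u_k) = [−Δ_{u_k} + a_kQ_k^*(u_k)Q_k(u_k)]^{−1}, (4.6.2) where −Δ_{u_k} = D^*_{u_k}D_{u_k}. (4.6.3)"*; [I] p. 309
[PDF 11]: *"Such zero modes do not occur … Similar, elementary reasoning yields an inductive proof for k > 1, but we leave out the details."*

WHAT `G_k(Ω,u)` IS, and what the tree had.  The paper never displays a formula for `G_k(Ω,u)`; by (5.6.10) and [I] (4.6.2)–(4.6.3) it is the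
inverse, on scalar fields supported in `Ω`, of the *"basic quadratic form with Neumann boundary conditions on Ω"* plus `a_kQ_k^*(u)Q_k(u)`:
`H_Ω(u) = −Δ^N_{u,Ω} + a_kQ_k^*(u)Q_k(u)`, `−Δ^N_{u,Ω} = D_u^*χ_{Ω*}D_u` (only the bonds `b ⊂ Ω`), `Q_k(u)` the `k`-level covariant block
average of [I] (2.6)/(4.6.1) over the `k`-blocks inside `Ω`.  In the tree: my gen-10 `BIJ88Vj5610Operator.hMat aj c u χ B w U` IS this
operator for any bond cut-off `χ` (Neumann: `chiN Ω`) and any block family — but as a matrix on ALL sites, and gen 10's (5.6.11)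
`eq5611_matrix` took the invertibilities `G₀·H = 1`, `H′·G = 1` on the WHOLE lattice as HYPOTHESES, satisfiable only for `Ω = T` (for a
proper `Ω` the operator kills the fields supported off `Ω`); p11's `BIJ85ScalarPropagatorTorusK` proves the no-zero-modes statement and
the existence of `G_k(u)` on the WHOLE torus (`hposK_torus`, `exists_GK`) in the real-linear-map framework.  THIS FILE supplies the
REGION version with bodies, in the matrix (= kernel) currency that (2.27)–(2.28)/(2.34) and my gen-10/11 files (`gLoc`, `eq5612_w6`) consume.

THE MECHANISM.  (companion `BIJ88NeumannNoZeroModesTorus`, §§1–2 there) `Ω` is a *union of `k`-blocks* (`IsBlockUnion k Ω`); `innerK k Ω` =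
the unit-lattice sites `y` with `B^k(y) ⊆ Ω` (the rows of `Q_k(u)` kept by the Neumann problem); the transport argument of [I] p. 309
localized to `Ω` gives **no zero modes on `Ω`**: `D_uφ = 0` on `Ω*` and `Q_k(u)φ = 0` on the inner blocks force `φ|_Ω = 0`
(`eq_zero_on_of_covD_qCovK`).  (§1) `H_Ω(u)` = `nOp a c U k Ω := hMat a c (cfg U) (chiN Ω) (blocksIn k Ω) L^{−kd}
(u(Γ^{(k)}))` BY NAME, `= (χ_ΩD_u)ᴴ(χ_ΩD_u) + a·(Q_k|_Ω)ᴴ(Q_k|_Ω)` (`nOp_eq`; `qMatK_mulVec`: the kept rows ARE p11's `qCovK`), supported on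
`Ω × Ω` (`nOp_mul_proj`, `proj_mul_nOp`), Hermitian.  (§2) PAD BY THE IDENTITY OFF `Ω`: `N = H_Ω + 1_{Ωᶜ}`; its quadratic form is
`φᴴNφ = Σ_{b⊂Ω}‖(D_uφ)(b)‖² + aΣ_{B^k(y)⊆Ω}‖(Q_kφ)(y)‖² + Σ_{x∉Ω}‖φ(x)‖²` (`form_nPad`), so `Nφ = 0 ⟹ φ = 0` by the no-zero-modes theorem (`eq_zero_of_nPad_mulVec_eq_zero`)
and `N` is invertible (`isUnit_nPad`, Mathlib `mulVec_injective_iff_isUnit`); **`G_k(Ω,u) := N^{−1}·1_Ω`** (`gBox`) satisfies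
`G·H_Ω = 1_Ω = H_Ω·G`, `G = 1_ΩG1_Ω`, `Gᴴ = G`, and is THE ONLY matrix with `G·H_Ω = 1_Ω`, `G·1_Ω = G` (`eq_gBox_of_left_inverse`; so the
padding is immaterial); on `Ω = T` it is the honest two-sided inverse (`gBox_univ_mul`).  (§3) For two fields `u`, `u′` on the same `Ω` the
four identities give (5.6.11) EXACTLY with `V_j(Ω) = H_Ω(u) − H_Ω(u′)` (= r16's ring-level `Vj`, `nOp_sub_nOp_eq_Vj`; its computed form
for `u′ = ue^a` is gen 10's `eq5610_matrix`), and — fed by name into gen 10's `BIJ88Eq5612W6.eq5612_w6_zero_defect` — (5.6.12) with NO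
kernel `w₆` for the region propagators themselves (`eq5612_gBox`).

WHAT IS PROVED (0 `sorry`, standard axioms; definitions with bodies `wK`, `blocksIn`, `trK`, `qMatK`, `dN`, `nOp`, `proj`, `cproj`, `nPad`,
`gBox` + theorems; no `Prop`-valued fact).
* §1 `conj_toC`, `toC_mul_conj`, `conj_mul_toC`, `wK_coe`, `qMatK_apply`, **`qMatK_mulVec`**, `dN_apply`, `dN_mulVec`,
  `chiN_conjTranspose_mul_chiN`, **`nOp_eq`**, `proj_add_cproj`, `proj_mul_proj`, `proj_mul_cproj`, `cproj_mul_proj`, `proj_conjTranspose`,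
  `cproj_conjTranspose`, `proj_mulVec`, `dN_mul_proj`, `qMatK_mul_proj`, `nOp_conjTranspose`, **`nOp_mul_proj`**, **`proj_mul_nOp`**,
  `proj_mul_nPad`, `nPad_mul_proj`, `nPad_conjTranspose`.
* §2 **`form_nPad`**, **`eq_zero_of_nPad_mulVec_eq_zero`**, **`isUnit_nPad`**, `proj_mul_nPad_inv`, **`gBox_mul_nOp`**, **`nOp_mul_gBox`**,
  `gBox_mul_proj`, `proj_mul_gBox`, `proj_mul_gBox_mul_proj`, `gBox_apply_eq_zero`, **`eq_gBox_of_left_inverse`**, `eq_gBox_of_right_inverse`,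
  **`gBox_conjTranspose`**, **`gBox_spec`**, `gBox_univ_mul`.
* §3 `eq5611_of_proj` (any ring), **`eq5611_gBox`**, `nOp_sub_nOp_eq_Vj`, **`eq5612_gBox`**.
HONEST SCOPE.  Construction and algebra only.  NOT here: the decay (2.30)/(2.31) of `G_{k,loc}` (*"a straightforward application of the
random walk expansion of [6]"* = B4's theorem; owner item 2 (ii), the B4-box ↔ torus-cube carrier bridge), the convex weights `λ_α` of
(2.27) on the torus (p13's `BIJ88ConvexWeights227.cwt` is the `ℤ^d` construction) and the assembly (2.27)–(2.28)/(2.34) (companion file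
`BIJ88DeltaLoc234Torus`, which also carries the GAUGE COVARIANCE `G_k(Ω,u^h)(x,y) = h(x)G_k(Ω,u)(x,y)h(y)^{−1}`), the size of `V_j(Ω)` (gen 10),
Hölder members.  Uniform lattice weights are absorbed into `c` (`= η^{−1}` for the covariant derivative), `a` and `L^{−kd}` as in gen 10;
the standing range is `j + k ≤ m + K`.  Imports: this seat's `BIJ88NeumannNoZeroModesTorus` (→ p11's `BIJ85ScalarPropagatorTorusK`:
level-`k` averages `qCovK`/`holCK`) and my gen-10 `BIJ88Eq5612W6` (→ `BIJ88Vj5610Operator`: `hMat`, `chiN`, `dMat`, `qMat`;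
`eq5612_w6_zero_defect`).
Unit `lit-balaban-p31` (literature-prover-lit-balaban-p31-g15-0), 2026-08-22.  NOT summit progress.
-/

open scoped BigOperators Matrix ComplexConjugate
open Finset Matrix

namespace Literature.MathematicalPhysics.QuantumFieldTheory.BalabanImbrieJaffe1984to88.BIJ88NeumannPropagator227Torus

open Literature.MathematicalPhysics.QuantumFieldTheory.Balaban1983to89
open BIJ88Sect3Statements (U1 toC cfg covD starB mem_starB toC_mul toC_one toC_inv norm_toC)
open BIJ85Sect1Model (HiggsField)
open BIJ85BlockAveragesTorus BIJ85BlockAveragesTorusK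
open BIJ85ScalarPropagatorTorus (covD_eq_zero_iff)
open BIJ88Vj5610Operator (dMat qMat chiN hMat dMat_mulVec qMat_mulVec)
open BIJ88Sect5StatementsPart4 (covAvg Vj)
open BIJ88NeumannNoZeroModesTorus
open GaugeField (gaugeAct)

noncomputable section

variable {P : Params} {j : ℕ}

/-! ## §1 The Neumann operator `−Δ^N_{u,Ω} + a_kQ_k^*(u)Q_k(u)` of `Ω` as a matrix (my gen-10 `hMat` with the Neumann cut-off `chiN Ω`) -/

section Algebra

variable {m n : Type*} [Fintype m] [Fintype n]

/-- kernel: `vᴴ(AᴴA)v = Σ_i ‖(Av)_i‖²` (a Gram form is a sum of squares). [folklore] -/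
private theorem form_gram (A : Matrix m n ℂ) (v : n → ℂ) :
    star v ⬝ᵥ ((Aᴴ * A) *ᵥ v) = ((∑ i, ‖(A *ᵥ v) i‖ ^ 2 : ℝ) : ℂ) := by
  rw [← mulVec_mulVec, dotProduct_mulVec, vecMul_conjTranspose, star_star]
  simp only [dotProduct, Pi.star_apply, Complex.ofReal_sum, Complex.ofReal_pow]
  refine Finset.sum_congr rfl fun i _ => ?_
  rw [Complex.star_def, ← Complex.normSq_eq_conj_mul_self, Complex.normSq_eq_norm_sq, Complex.ofReal_pow]

end Algebra

/-- kernel: `conj u = u⁻¹` and `u·conj u = 1` for a `U(1)` variable read in `ℂ`. [cite: BalabanImbrieJaffe1985, (2.5) p.302] -/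
theorem conj_toC (g : U1) : (starRingEnd ℂ) (toC g) = (toC g)⁻¹ := by rw [← toC_inv, toC_inv']

/-- kernel: `u·conj u = 1` on `U(1)`. [cite: BalabanImbrieJaffe1985, (2.5) p.302] -/
theorem toC_mul_conj (g : U1) : toC g * (starRingEnd ℂ) (toC g) = 1 := by
  rw [conj_toC, mul_inv_cancel₀ (toC_ne_zero g)]

/-- kernel: `conj u·u = 1` on `U(1)`. [cite: BalabanImbrieJaffe1985, (2.5) p.302] -/
theorem conj_mul_toC (g : U1) : (starRingEnd ℂ) (toC g) * toC g = 1 := by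
  rw [mul_comm, toC_mul_conj]

/-- The weight `L^{−kd}` of the `k`-level average (p. 309: *"where L is replaced by L^k"*). [cite: BalabanImbrieJaffe1985, (2.6) p.303] -/
def wK (P : Params) (k : ℕ) : ℝ := ((P.L : ℝ) ^ (k * P.d))⁻¹

/-- kernel: the weight read in `ℂ`. [cite: BalabanImbrieJaffe1985, (2.6) p.303] -/
theorem wK_coe (P : Params) (k : ℕ) : ((wK P k : ℝ) : ℂ) = ((P.L : ℂ) ^ (k * P.d))⁻¹ := by
  unfold wK; push_cast; rfl

/-- The blocks KEPT by the Neumann problem on `Ω`: `B^k(y)` if it lies inside `Ω`, nothing otherwise (the restriction of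
`a_kQ_k^*(u)Q_k(u)` to `ℓ²(Ω)`). [cite: BalabanImbrieJaffe1988, (2.27) p.263] -/
def blocksIn (k : ℕ) (Ω : Finset (Balaban1983to89.Site P j)) (y : Balaban1983to89.Site P (j+k)) : Finset (Balaban1983to89.Site P j) :=
  if blockK k y ⊆ Ω then blockK k y else ∅

/-- The transporters `u(Γ^{(k)}_{yx})` of the `k`-level average (p11's `holCK`), in the two-argument shape of my gen-10 `qMat`.
[cite: BalabanImbrieJaffe1985, (5.1.2)–(5.1.3) p.313] -/
def trK (U : GaugeField P j U1) (k : ℕ) : Balaban1983to89.Site P (j+k) → Balaban1983to89.Site P j → ℂ := fun _ x => holCK U k x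

/-- **`Q_k(u)` restricted to `Ω`** as a matrix (unit-lattice site ← `η`-lattice site): the rows `y` with `B^k(y) ⊆ Ω` of the `k`-level
covariant average of [I] (4.6.1) (my gen-10 `qMat` over the kept blocks). [cite: BalabanImbrieJaffe1988, (2.27) p.263] -/
def qMatK (U : GaugeField P j U1) (k : ℕ) (Ω : Finset (Balaban1983to89.Site P j)) :
    Matrix (Balaban1983to89.Site P (j+k)) (Balaban1983to89.Site P j) ℂ :=
  qMat (blocksIn k Ω) (wK P k) (trK U k)

/-- kernel: the entries of `Q_k(u)|_Ω`. [cite: BalabanImbrieJaffe1988, (2.27) p.263] -/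
theorem qMatK_apply (U : GaugeField P j U1) (k : ℕ) (Ω : Finset (Balaban1983to89.Site P j)) (y : Balaban1983to89.Site P (j+k))
    (x : Balaban1983to89.Site P j) :
    qMatK U k Ω y x = if blockK k y ⊆ Ω ∧ x ∈ blockK k y then ((P.L : ℂ) ^ (k * P.d))⁻¹ * holCK U k x else 0 := by
  unfold qMatK qMat blocksIn trK
  rw [Matrix.of_apply, wK_coe]
  by_cases h1 : blockK k y ⊆ Ω
  · simp only [h1, if_true, true_and]
  · simp only [h1, if_false, Finset.notMem_empty, false_and]

/-- kernel: **`(Q_k(u)|_Ωφ)(y) = (Q_k(u)φ)(y)`** (p11's `qCovK`, the printed `k`-fold average) on the kept rows, `0` on the others.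
[cite: BalabanImbrieJaffe1985, (4.6.1) p.313] -/
theorem qMatK_mulVec (U : GaugeField P j U1) (k : ℕ) (Ω : Finset (Balaban1983to89.Site P j)) (φ : Balaban1983to89.Site P j → ℂ)
    (y : Balaban1983to89.Site P (j+k)) :
    (qMatK U k Ω *ᵥ φ) y = if blockK k y ⊆ Ω then qCovK U k φ y else 0 := by
  unfold qMatK
  rw [qMat_mulVec, covAvg, qCovK_apply, wK_coe, Finset.mul_sum]
  unfold blocksIn trK
  by_cases h1 : blockK k y ⊆ Ω
  · simp only [h1, if_true]
    exact Finset.sum_congr rfl fun x _ => by ring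
  · simp only [h1, if_false, Finset.sum_empty]

/-- **The Neumann-cut covariant derivative `χ_ΩD_u`** (rows = the bonds `b ⊂ Ω`, my gen-10 `chiN Ω * dMat c u`): the operator whose
Gram matrix is `−Δ^N_{u,Ω}` (`form_lapN`). [cite: BalabanImbrieJaffe1988, (5.6.10) p.287] -/
def dN (c : ℝ) (U : GaugeField P j U1) (Ω : Finset (Balaban1983to89.Site P j)) : Matrix (PBond P j) (Balaban1983to89.Site P j) ℂ :=
  chiN Ω * dMat c (cfg U)

open Classical in
/-- kernel: the entries of `χ_ΩD_u`. [cite: BalabanImbrieJaffe1988, (5.6.10) p.287] -/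
theorem dN_apply (c : ℝ) (U : GaugeField P j U1) (Ω : Finset (Balaban1983to89.Site P j)) (b : PBond P j) (x : Balaban1983to89.Site P j) :
    dN c U Ω b x = if b ∈ starB Ω then dMat c (cfg U) b x else 0 := by
  unfold dN chiN
  rw [diagonal_mul]
  split_ifs <;> simp

open Classical in
/-- kernel: `(χ_ΩD_uφ)(b) = (D_uφ)(b)` for `b ⊂ Ω`, `0` otherwise. [cite: BalabanImbrieJaffe1988, (5.6.10) p.287] -/
theorem dN_mulVec (c : ℝ) (U : GaugeField P j U1) (Ω : Finset (Balaban1983to89.Site P j)) (φ : Balaban1983to89.Site P j → ℂ)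
    (b : PBond P j) : (dN c U Ω *ᵥ φ) b = if b ∈ starB Ω then covD c (cfg U) φ b else 0 := by
  unfold dN chiN
  rw [← mulVec_mulVec, mulVec_diagonal, dMat_mulVec]
  split_ifs <;> simp

open Classical in
/-- kernel: the Neumann cut-off is an orthogonal projection: `χ_Ωᴴ = χ_Ω`, `χ_Ω² = χ_Ω`. [cite: BalabanImbrieJaffe1988, (5.6.10) p.287] -/
theorem chiN_conjTranspose_mul_chiN (Ω : Finset (Balaban1983to89.Site P j)) : (chiN Ω)ᴴ * chiN Ω = chiN Ω := by
  unfold chiN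
  rw [diagonal_conjTranspose, diagonal_mul_diagonal]
  congr 1
  funext b
  by_cases h : b ∈ starB Ω <;> simp [h]

/-- **`−Δ^N_{u,Ω} + a_kQ_k^*(u)Q_k(u)`**, the operator of the Neumann problem on `Ω` ((5.6.10) *"the basic quadratic form with Neumann
boundary conditions on Ω giving rise to G_j(Ω)"*; [I] (4.6.2) with `Ω` in place of the torus) — BY NAME my gen-10 `hMat` with the Neumann
cut-off `chiN Ω` and the `k`-level average of record restricted to the blocks inside `Ω`; as a matrix on ALL sites of `T^{(j)}` it
vanishes outside `Ω × Ω` (`proj_mul_nOp`, `nOp_mul_proj`). [cite: BalabanImbrieJaffe1988, (2.27) p.263] -/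
def nOp (a c : ℝ) (U : GaugeField P j U1) (k : ℕ) (Ω : Finset (Balaban1983to89.Site P j)) :
    Matrix (Balaban1983to89.Site P j) (Balaban1983to89.Site P j) ℂ :=
  hMat a c (cfg U) (chiN Ω) (blocksIn k Ω) (wK P k) (trK U k)

/-- kernel: the operator as a sum of two Gram matrices, `(χ_ΩD_u)ᴴ(χ_ΩD_u) + a·(Q_k|_Ω)ᴴ(Q_k|_Ω)`. [cite: BalabanImbrieJaffe1988, (5.6.10) p.287] -/
theorem nOp_eq (a c : ℝ) (U : GaugeField P j U1) (k : ℕ) (Ω : Finset (Balaban1983to89.Site P j)) :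
    nOp a c U k Ω = (dN c U Ω)ᴴ * dN c U Ω + (a : ℂ) • ((qMatK U k Ω)ᴴ * qMatK U k Ω) := by
  have h : (chiN Ω * dMat c (cfg U))ᴴ * (chiN Ω * dMat c (cfg U)) = (dMat c (cfg U))ᴴ * chiN Ω * dMat c (cfg U) := by
    rw [conjTranspose_mul, Matrix.mul_assoc, ← Matrix.mul_assoc ((chiN Ω)ᴴ), chiN_conjTranspose_mul_chiN, Matrix.mul_assoc]
  unfold nOp hMat dN qMatK
  rw [h]

/-- The orthogonal projection `1_Ω` onto `ℓ²(Ω) ⊂ ℓ²(T^{(j)})`. [cite: BalabanImbrieJaffe1988, (2.27) p.263] -/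
def proj (Ω : Finset (Balaban1983to89.Site P j)) : Matrix (Balaban1983to89.Site P j) (Balaban1983to89.Site P j) ℂ :=
  diagonal fun x => if x ∈ Ω then 1 else 0

/-- The complementary projection `1_{Ωᶜ}`. [cite: BalabanImbrieJaffe1988, (2.27) p.263] -/
def cproj (Ω : Finset (Balaban1983to89.Site P j)) : Matrix (Balaban1983to89.Site P j) (Balaban1983to89.Site P j) ℂ :=
  diagonal fun x => if x ∈ Ω then 0 else 1

/-- kernel: `1_Ω + 1_{Ωᶜ} = 1`. [cite: BalabanImbrieJaffe1988, (2.27) p.263] -/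
theorem proj_add_cproj (Ω : Finset (Balaban1983to89.Site P j)) : proj Ω + cproj Ω = 1 := by
  unfold proj cproj
  rw [diagonal_add, ← diagonal_one]
  congr 1; funext x; split_ifs <;> simp

/-- kernel: `1_Ω² = 1_Ω`. [cite: BalabanImbrieJaffe1988, (2.27) p.263] -/
theorem proj_mul_proj (Ω : Finset (Balaban1983to89.Site P j)) : proj Ω * proj Ω = proj Ω := by
  unfold proj; rw [diagonal_mul_diagonal]; congr 1; funext x; split_ifs <;> simp

/-- kernel: `1_Ω·1_{Ωᶜ} = 0`. [cite: BalabanImbrieJaffe1988, (2.27) p.263] -/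
theorem proj_mul_cproj (Ω : Finset (Balaban1983to89.Site P j)) : proj Ω * cproj Ω = 0 := by
  unfold proj cproj; rw [diagonal_mul_diagonal, ← diagonal_zero]; congr 1; funext x; split_ifs <;> simp

/-- kernel: `1_{Ωᶜ}·1_Ω = 0`. [cite: BalabanImbrieJaffe1988, (2.27) p.263] -/
theorem cproj_mul_proj (Ω : Finset (Balaban1983to89.Site P j)) : cproj Ω * proj Ω = 0 := by
  unfold proj cproj; rw [diagonal_mul_diagonal, ← diagonal_zero]; congr 1; funext x; split_ifs <;> simp

/-- kernel: `1_Ωᴴ = 1_Ω`. [cite: BalabanImbrieJaffe1988, (2.27) p.263] -/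
theorem proj_conjTranspose (Ω : Finset (Balaban1983to89.Site P j)) : (proj Ω)ᴴ = proj Ω := by
  unfold proj; rw [diagonal_conjTranspose]; congr 1; funext x; by_cases h : x ∈ Ω <;> simp [h]

/-- kernel: `1_{Ωᶜ}ᴴ = 1_{Ωᶜ}`. [cite: BalabanImbrieJaffe1988, (2.27) p.263] -/
theorem cproj_conjTranspose (Ω : Finset (Balaban1983to89.Site P j)) : (cproj Ω)ᴴ = cproj Ω := by
  unfold cproj; rw [diagonal_conjTranspose]; congr 1; funext x; by_cases h : x ∈ Ω <;> simp [h]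

/-- kernel: `(1_Ωφ)(x) = φ(x)` on `Ω`, `0` off `Ω`. [cite: BalabanImbrieJaffe1988, (2.27) p.263] -/
theorem proj_mulVec (Ω : Finset (Balaban1983to89.Site P j)) (φ : Balaban1983to89.Site P j → ℂ) (x : Balaban1983to89.Site P j) :
    (proj Ω *ᵥ φ) x = if x ∈ Ω then φ x else 0 := by
  unfold proj; rw [mulVec_diagonal]; split_ifs <;> simp

/-- kernel: the columns of `χ_ΩD_u` are supported in `Ω`: `χ_ΩD_u·1_Ω = χ_ΩD_u`. [cite: BalabanImbrieJaffe1988, (5.6.10) p.287] -/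
theorem dN_mul_proj (c : ℝ) (U : GaugeField P j U1) (Ω : Finset (Balaban1983to89.Site P j)) : dN c U Ω * proj Ω = dN c U Ω := by
  ext b x
  unfold proj
  rw [mul_diagonal, dN_apply]
  by_cases hx : x ∈ Ω
  · rw [if_pos hx, mul_one]
  · rw [if_neg hx, mul_zero]
    by_cases hb : b ∈ starB Ω
    · obtain ⟨hs, ht⟩ := (mem_starB Ω b).1 hb
      have h1 : x ≠ b.tgt := fun h => hx (h ▸ ht)
      have h2 : x ≠ b.src := fun h => hx (h ▸ hs)
      rw [if_pos hb]
      simp [dMat, h1, h2]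
    · rw [if_neg hb]

/-- kernel: the columns of `Q_k(u)|_Ω` are supported in `Ω`. [cite: BalabanImbrieJaffe1988, (2.27) p.263] -/
theorem qMatK_mul_proj (U : GaugeField P j U1) (k : ℕ) (Ω : Finset (Balaban1983to89.Site P j)) : qMatK U k Ω * proj Ω = qMatK U k Ω := by
  ext y x
  unfold proj
  rw [mul_diagonal, qMatK_apply]
  by_cases hx : x ∈ Ω
  · rw [if_pos hx, mul_one]
  · rw [if_neg hx, mul_zero]
    split_ifs with h
    · exact absurd (h.1 h.2) hx
    · rfl

/-- kernel: `nOp` is Hermitian (two Gram matrices, `a` real). [cite: BalabanImbrieJaffe1988, (5.6.10) p.287] -/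
theorem nOp_conjTranspose (a c : ℝ) (U : GaugeField P j U1) (k : ℕ) (Ω : Finset (Balaban1983to89.Site P j)) :
    (nOp a c U k Ω)ᴴ = nOp a c U k Ω := by
  rw [nOp_eq, conjTranspose_add, conjTranspose_smul, conjTranspose_mul, conjTranspose_mul, conjTranspose_conjTranspose,
    conjTranspose_conjTranspose, Complex.star_def, Complex.conj_ofReal]

/-- kernel: **`nOp·1_Ω = nOp`** — the operator lives on `ℓ²(Ω)`. [cite: BalabanImbrieJaffe1988, (2.27) p.263] -/
theorem nOp_mul_proj (a c : ℝ) (U : GaugeField P j U1) (k : ℕ) (Ω : Finset (Balaban1983to89.Site P j)) :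
    nOp a c U k Ω * proj Ω = nOp a c U k Ω := by
  rw [nOp_eq, Matrix.add_mul, Matrix.smul_mul, Matrix.mul_assoc, dN_mul_proj, Matrix.mul_assoc, qMatK_mul_proj]

/-- kernel: **`1_Ω·nOp = nOp`**. [cite: BalabanImbrieJaffe1988, (2.27) p.263] -/
theorem proj_mul_nOp (a c : ℝ) (U : GaugeField P j U1) (k : ℕ) (Ω : Finset (Balaban1983to89.Site P j)) :
    proj Ω * nOp a c U k Ω = nOp a c U k Ω := by
  have h := congrArg conjTranspose (nOp_mul_proj a c U k Ω)
  rwa [conjTranspose_mul, proj_conjTranspose, nOp_conjTranspose] at h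

/-- The operator PADDED BY THE IDENTITY OFF `Ω`: `N = nOp + 1_{Ωᶜ}` — invertible on all of `ℓ²(T^{(j)})` exactly when the Neumann
problem on `Ω` has no zero modes; its inverse restricted to `Ω` is `G_k(Ω,u)`. [cite: BalabanImbrieJaffe1988, (2.27) p.263] -/
def nPad (a c : ℝ) (U : GaugeField P j U1) (k : ℕ) (Ω : Finset (Balaban1983to89.Site P j)) :
    Matrix (Balaban1983to89.Site P j) (Balaban1983to89.Site P j) ℂ :=
  nOp a c U k Ω + cproj Ω

/-- kernel: `1_Ω·N = nOp = N·1_Ω`. [cite: BalabanImbrieJaffe1988, (2.27) p.263] -/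
theorem proj_mul_nPad (a c : ℝ) (U : GaugeField P j U1) (k : ℕ) (Ω : Finset (Balaban1983to89.Site P j)) :
    proj Ω * nPad a c U k Ω = nOp a c U k Ω := by
  rw [nPad, Matrix.mul_add, proj_mul_nOp, proj_mul_cproj, add_zero]

/-- kernel: `N·1_Ω = nOp`. [cite: BalabanImbrieJaffe1988, (2.27) p.263] -/
theorem nPad_mul_proj (a c : ℝ) (U : GaugeField P j U1) (k : ℕ) (Ω : Finset (Balaban1983to89.Site P j)) :
    nPad a c U k Ω * proj Ω = nOp a c U k Ω := by
  rw [nPad, Matrix.add_mul, nOp_mul_proj, cproj_mul_proj, add_zero]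

/-- kernel: `N` is Hermitian. [cite: BalabanImbrieJaffe1988, (2.27) p.263] -/
theorem nPad_conjTranspose (a c : ℝ) (U : GaugeField P j U1) (k : ℕ) (Ω : Finset (Balaban1983to89.Site P j)) :
    (nPad a c U k Ω)ᴴ = nPad a c U k Ω := by
  rw [nPad, conjTranspose_add, nOp_conjTranspose, cproj_conjTranspose]

/-! ## §2 The quadratic form; invertibility; `G_k(Ω,u)` -/

open Classical in
/-- **THE QUADRATIC FORM OF THE PADDED NEUMANN OPERATOR**: `φᴴNφ = Σ_{b⊂Ω}‖(D_uφ)(b)‖² + a·Σ_{B^k(y)⊆Ω}‖(Q_k(u)φ)(y)‖² + Σ_{x∉Ω}‖φ(x)‖²`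
(real, nonnegative; the first member is (5.6.10)'s *"basic quadratic form with Neumann boundary conditions on Ω"*, cf. my gen-10 `form_lapN`).
[cite: BalabanImbrieJaffe1988, (5.6.10) p.287] -/
theorem form_nPad (a c : ℝ) (U : GaugeField P j U1) (k : ℕ) (Ω : Finset (Balaban1983to89.Site P j)) (φ : Balaban1983to89.Site P j → ℂ) :
    star φ ⬝ᵥ (nPad a c U k Ω *ᵥ φ) =
      ((∑ b ∈ starB Ω, ‖covD c (cfg U) φ b‖ ^ 2 + a * ∑ y ∈ innerK k Ω, ‖qCovK U k φ y‖ ^ 2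
          + ∑ x ∈ Ωᶜ, ‖φ x‖ ^ 2 : ℝ) : ℂ) := by
  rw [nPad, nOp_eq, add_mulVec, add_mulVec, smul_mulVec, dotProduct_add, dotProduct_add, dotProduct_smul, form_gram, form_gram]
  have h1 : (∑ i, ‖(dN c U Ω *ᵥ φ) i‖ ^ 2 : ℝ) = ∑ b ∈ starB Ω, ‖covD c (cfg U) φ b‖ ^ 2 := by
    rw [← Finset.sum_filter_add_sum_filter_not Finset.univ (fun b => b ∈ starB Ω)]
    have hz : ∑ b ∈ Finset.univ.filter (fun b => ¬ b ∈ starB Ω), ‖(dN c U Ω *ᵥ φ) b‖ ^ 2 = (0 : ℝ) :=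
      Finset.sum_eq_zero fun b hb => by
        rw [Finset.mem_filter] at hb
        rw [dN_mulVec, if_neg hb.2, norm_zero, zero_pow two_ne_zero]
    rw [hz, add_zero, show Finset.univ.filter (fun b => b ∈ starB Ω) = starB Ω from by ext b; simp]
    exact Finset.sum_congr rfl fun b hb => by rw [dN_mulVec, if_pos hb]
  have h2 : (∑ i, ‖(qMatK U k Ω *ᵥ φ) i‖ ^ 2 : ℝ) = ∑ y ∈ innerK k Ω, ‖qCovK U k φ y‖ ^ 2 := by
    rw [← Finset.sum_filter_add_sum_filter_not Finset.univ (fun y => blockK k y ⊆ Ω)]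
    have hz : ∑ y ∈ Finset.univ.filter (fun y => ¬ blockK k y ⊆ Ω), ‖(qMatK U k Ω *ᵥ φ) y‖ ^ 2 = (0 : ℝ) :=
      Finset.sum_eq_zero fun y hy => by
        rw [Finset.mem_filter] at hy
        rw [qMatK_mulVec, if_neg hy.2, norm_zero, zero_pow two_ne_zero]
    rw [hz, add_zero]
    refine Finset.sum_congr (by ext y; simp [innerK]) fun y hy => ?_
    rw [qMatK_mulVec, if_pos (mem_innerK.1 hy)]
  have h3 : star φ ⬝ᵥ (cproj Ω *ᵥ φ) = ((∑ x ∈ Ωᶜ, ‖φ x‖ ^ 2 : ℝ) : ℂ) := by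
    unfold cproj
    simp only [dotProduct, mulVec_diagonal, Pi.star_apply]
    rw [← Finset.sum_filter_add_sum_filter_not Finset.univ (fun x => x ∈ Ω)]
    have hz : ∑ x ∈ Finset.univ.filter (fun x => x ∈ Ω), star (φ x) * ((if x ∈ Ω then (0 : ℂ) else 1) * φ x) = 0 :=
      Finset.sum_eq_zero fun x hx => by
        rw [Finset.mem_filter] at hx
        simp [hx.2]
    rw [hz, zero_add, Complex.ofReal_sum, show Finset.univ.filter (fun x => ¬ x ∈ Ω) = Ωᶜ from by ext x; simp]
    refine Finset.sum_congr rfl fun x hx => ?_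
    rw [Finset.mem_compl] at hx
    rw [if_neg hx, one_mul, Complex.star_def, ← Complex.normSq_eq_conj_mul_self, Complex.normSq_eq_norm_sq, Complex.ofReal_pow]
  rw [h1, h2, h3, smul_eq_mul]
  push_cast
  ring

/-- **THE PADDED NEUMANN OPERATOR HAS TRIVIAL KERNEL** (`Ω` a union of `k`-blocks, `a > 0`, `c ≠ 0`, standing range; every `U(1)` field
`u`): `Nφ = 0 ⟹ φ = 0` — the three squares of `form_nPad` vanish, so `D_uφ = 0` on `Ω*`, `Q_k(u)φ = 0` on the blocks inside `Ω`, `φ = 0`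
off `Ω`, and the companion's `eq_zero_on_of_covD_qCovK` (no zero modes on `Ω`) finishes. [cite: BalabanImbrieJaffe1988, (2.27) p.263] -/
theorem eq_zero_of_nPad_mulVec_eq_zero {k : ℕ} (hk : j + k ≤ P.m + P.K) {c : ℝ} (hc : c ≠ 0) {a : ℝ} (ha : 0 < a)
    (U : GaugeField P j U1) {Ω : Finset (Balaban1983to89.Site P j)} (hΩ : IsBlockUnion k Ω)
    {φ : Balaban1983to89.Site P j → ℂ} (h : nPad a c U k Ω *ᵥ φ = 0) : φ = 0 := by
  have hf := form_nPad a c U k Ω φ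
  rw [h, dotProduct_zero] at hf
  have hR := (Complex.ofReal_eq_zero.1 hf.symm)
  have s1 : 0 ≤ ∑ b ∈ starB Ω, ‖covD c (cfg U) φ b‖ ^ 2 := Finset.sum_nonneg fun _ _ => by positivity
  have s2 : 0 ≤ a * ∑ y ∈ innerK k Ω, ‖qCovK U k φ y‖ ^ 2 := mul_nonneg ha.le (Finset.sum_nonneg fun _ _ => by positivity)
  have s3 : 0 ≤ ∑ x ∈ Ωᶜ, ‖φ x‖ ^ 2 := Finset.sum_nonneg fun _ _ => by positivity
  have e1 : ∑ b ∈ starB Ω, ‖covD c (cfg U) φ b‖ ^ 2 = 0 := by linarith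
  have e2 : ∑ y ∈ innerK k Ω, ‖qCovK U k φ y‖ ^ 2 = 0 := by nlinarith
  have e3 : ∑ x ∈ Ωᶜ, ‖φ x‖ ^ 2 = 0 := by linarith
  have hD : ∀ b ∈ starB Ω, covD c (cfg U) φ b = 0 := fun b hb => by
    have := (Finset.sum_eq_zero_iff_of_nonneg (fun _ _ => by positivity)).1 e1 b hb
    rwa [sq_eq_zero_iff, norm_eq_zero] at this
  have hQ : ∀ y ∈ innerK k Ω, qCovK U k φ y = 0 := fun y hy => by
    have := (Finset.sum_eq_zero_iff_of_nonneg (fun _ _ => by positivity)).1 e2 y hy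
    rwa [sq_eq_zero_iff, norm_eq_zero] at this
  have hout : ∀ x ∈ Ωᶜ, φ x = 0 := fun x hx => by
    have := (Finset.sum_eq_zero_iff_of_nonneg (fun _ _ => by positivity)).1 e3 x hx
    rwa [sq_eq_zero_iff, norm_eq_zero] at this
  funext x
  by_cases hx : x ∈ Ω
  · exact eq_zero_on_of_covD_qCovK hk hc hΩ hD hQ x hx
  · exact hout x (Finset.mem_compl.2 hx)

/-- **THE PADDED NEUMANN OPERATOR IS INVERTIBLE** (`Ω` a union of `k`-blocks, `a > 0`, `c ≠ 0`, `j + k ≤ m + K`; EVERY `U(1)` field `u` —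
no small-field or gauge condition). [cite: BalabanImbrieJaffe1988, (2.27) p.263] -/
theorem isUnit_nPad {k : ℕ} (hk : j + k ≤ P.m + P.K) {c : ℝ} (hc : c ≠ 0) {a : ℝ} (ha : 0 < a) (U : GaugeField P j U1)
    {Ω : Finset (Balaban1983to89.Site P j)} (hΩ : IsBlockUnion k Ω) : IsUnit (nPad a c U k Ω) := by
  rw [← mulVec_injective_iff_isUnit]
  intro v w hvw
  have h0 : nPad a c U k Ω *ᵥ (v - w) = 0 := by rw [mulVec_sub, hvw, sub_self]
  exact sub_eq_zero.1 (eq_zero_of_nPad_mulVec_eq_zero hk hc ha U hΩ h0)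

/-- **`G_k(Ω,u)`, THE NEUMANN PROPAGATOR OF `Ω`** (p. 262 *"the η-lattice propagators G_k(Ω,u) defined on subsets Ω ⊂ T_η with Neumann
boundary conditions"*; (2.27) `G_k(□_α,u)`; (5.6.10)–(5.6.11) `G_j(Ω,·)`): the inverse of `−Δ^N_{u,Ω} + a_kQ_k^*(u)Q_k(u)` on `ℓ²(Ω)`,
extended by `0` — as a matrix on `T^{(j)}`, `G_k(Ω,u) := N^{−1}·1_Ω`. [cite: BalabanImbrieJaffe1988, (2.27) p.263] -/
def gBox (a c : ℝ) (U : GaugeField P j U1) (k : ℕ) (Ω : Finset (Balaban1983to89.Site P j)) :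
    Matrix (Balaban1983to89.Site P j) (Balaban1983to89.Site P j) ℂ :=
  (nPad a c U k Ω)⁻¹ * proj Ω

section Inverse

variable {k : ℕ} {a c : ℝ} {U : GaugeField P j U1} {Ω : Finset (Balaban1983to89.Site P j)}

/-- kernel: `1_Ω` commutes with `N⁻¹` (it commutes with `N`). [cite: BalabanImbrieJaffe1988, (2.27) p.263] -/
theorem proj_mul_nPad_inv (hN : IsUnit (nPad a c U k Ω)) : proj Ω * (nPad a c U k Ω)⁻¹ = (nPad a c U k Ω)⁻¹ * proj Ω := by
  have hd := (isUnit_iff_isUnit_det _).1 hN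
  calc proj Ω * (nPad a c U k Ω)⁻¹
      = (nPad a c U k Ω)⁻¹ * nPad a c U k Ω * proj Ω * (nPad a c U k Ω)⁻¹ := by rw [nonsing_inv_mul _ hd, Matrix.one_mul]
    _ = (nPad a c U k Ω)⁻¹ * (proj Ω * nPad a c U k Ω) * (nPad a c U k Ω)⁻¹ := by
        rw [Matrix.mul_assoc ((nPad a c U k Ω)⁻¹), nPad_mul_proj, ← proj_mul_nPad]
    _ = (nPad a c U k Ω)⁻¹ * proj Ω := by rw [Matrix.mul_assoc, Matrix.mul_assoc, mul_nonsing_inv _ hd, Matrix.mul_one]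

/-- **`G_k(Ω,u)·(−Δ^N_{u,Ω} + a_kQ_k^*Q_k) = 1_Ω`** (left inverse on `ℓ²(Ω)`), given the invertibility of the padded operator
(`isUnit_nPad`). [cite: BalabanImbrieJaffe1988, (2.27) p.263] -/
theorem gBox_mul_nOp (hN : IsUnit (nPad a c U k Ω)) : gBox a c U k Ω * nOp a c U k Ω = proj Ω := by
  rw [gBox, Matrix.mul_assoc, proj_mul_nOp, ← nPad_mul_proj, ← Matrix.mul_assoc,
    nonsing_inv_mul _ ((isUnit_iff_isUnit_det _).1 hN), Matrix.one_mul]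

/-- **`(−Δ^N_{u,Ω} + a_kQ_k^*Q_k)·G_k(Ω,u) = 1_Ω`** (right inverse on `ℓ²(Ω)`). [cite: BalabanImbrieJaffe1988, (2.27) p.263] -/
theorem nOp_mul_gBox (hN : IsUnit (nPad a c U k Ω)) : nOp a c U k Ω * gBox a c U k Ω = proj Ω := by
  rw [gBox, ← Matrix.mul_assoc, ← proj_mul_nPad, Matrix.mul_assoc (proj Ω),
    mul_nonsing_inv _ ((isUnit_iff_isUnit_det _).1 hN), Matrix.mul_one, proj_mul_proj]

/-- kernel: `G_k(Ω,u)·1_Ω = G_k(Ω,u)`. [cite: BalabanImbrieJaffe1988, (2.27) p.263] -/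
theorem gBox_mul_proj : gBox a c U k Ω * proj Ω = gBox a c U k Ω := by
  rw [gBox, Matrix.mul_assoc, proj_mul_proj]

/-- kernel: `1_Ω·G_k(Ω,u) = G_k(Ω,u)`. [cite: BalabanImbrieJaffe1988, (2.27) p.263] -/
theorem proj_mul_gBox (hN : IsUnit (nPad a c U k Ω)) : proj Ω * gBox a c U k Ω = gBox a c U k Ω := by
  rw [gBox, ← Matrix.mul_assoc, proj_mul_nPad_inv hN, Matrix.mul_assoc, proj_mul_proj]

/-- kernel: `G_k(Ω,u) = 1_Ω·G_k(Ω,u)·1_Ω` — the propagator lives on `Ω × Ω`. [cite: BalabanImbrieJaffe1988, (2.27) p.263] -/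
theorem proj_mul_gBox_mul_proj (hN : IsUnit (nPad a c U k Ω)) : proj Ω * gBox a c U k Ω * proj Ω = gBox a c U k Ω := by
  rw [proj_mul_gBox hN, gBox_mul_proj]

/-- kernel: **`G_k(Ω,u;x,y) = 0` unless `x, y ∈ Ω`**. [cite: BalabanImbrieJaffe1988, (2.27) p.263] -/
theorem gBox_apply_eq_zero (hN : IsUnit (nPad a c U k Ω)) {x y : Balaban1983to89.Site P j} (h : x ∉ Ω ∨ y ∉ Ω) :
    gBox a c U k Ω x y = 0 := by
  rw [← proj_mul_gBox_mul_proj hN]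
  unfold proj
  rw [mul_diagonal, diagonal_mul]
  rcases h with h | h
  · rw [if_neg h, zero_mul, zero_mul]
  · rw [if_neg h, mul_zero]

/-- **UNIQUENESS**: any `G` with `G·nOp = 1_Ω` and `G·1_Ω = G` IS `G_k(Ω,u)` (so the construction does not depend on the padding chosen
off `Ω`). [cite: BalabanImbrieJaffe1988, (2.27) p.263] -/
theorem eq_gBox_of_left_inverse (hN : IsUnit (nPad a c U k Ω)) {G : Matrix (Balaban1983to89.Site P j) (Balaban1983to89.Site P j) ℂ}
    (hG : G * nOp a c U k Ω = proj Ω) (hGP : G * proj Ω = G) : G = gBox a c U k Ω := by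
  calc G = G * proj Ω := hGP.symm
    _ = G * (nOp a c U k Ω * gBox a c U k Ω) := by rw [nOp_mul_gBox hN]
    _ = G * nOp a c U k Ω * gBox a c U k Ω := by rw [Matrix.mul_assoc]
    _ = gBox a c U k Ω := by rw [hG, proj_mul_gBox hN]

/-- **UNIQUENESS (right form)**: `nOp·G = 1_Ω` and `1_Ω·G = G` force `G = G_k(Ω,u)`. [cite: BalabanImbrieJaffe1988, (2.27) p.263] -/
theorem eq_gBox_of_right_inverse (hN : IsUnit (nPad a c U k Ω)) {G : Matrix (Balaban1983to89.Site P j) (Balaban1983to89.Site P j) ℂ}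
    (hG : nOp a c U k Ω * G = proj Ω) (hPG : proj Ω * G = G) : G = gBox a c U k Ω := by
  calc G = proj Ω * G := hPG.symm
    _ = gBox a c U k Ω * nOp a c U k Ω * G := by rw [gBox_mul_nOp hN]
    _ = gBox a c U k Ω := by rw [Matrix.mul_assoc, hG, gBox_mul_proj]

/-- **`G_k(Ω,u)` is Hermitian** (`G(x,y) = conj G(y,x)`; the operator is). [cite: BalabanImbrieJaffe1988, (2.27) p.263] -/
theorem gBox_conjTranspose (hN : IsUnit (nPad a c U k Ω)) : (gBox a c U k Ω)ᴴ = gBox a c U k Ω := by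
  rw [gBox, conjTranspose_mul, proj_conjTranspose, conjTranspose_nonsing_inv, nPad_conjTranspose, proj_mul_nPad_inv hN]

/-- **THE CONSTRUCTION, ASSEMBLED**: for every `U(1)` field `u`, every union `Ω` of `k`-blocks, `a_k > 0`, `c ≠ 0` and `j + k ≤ m + K`,
`G_k(Ω,u)` is a two-sided inverse of `−Δ^N_{u,Ω} + a_kQ_k^*(u)Q_k(u)` on `ℓ²(Ω)`, supported on `Ω × Ω`, Hermitian.
[cite: BalabanImbrieJaffe1988, (2.27) p.263] -/
theorem gBox_spec (hk : j + k ≤ P.m + P.K) (hc : c ≠ 0) (ha : 0 < a) (U : GaugeField P j U1) (hΩ : IsBlockUnion k Ω) :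
    gBox a c U k Ω * nOp a c U k Ω = proj Ω ∧ nOp a c U k Ω * gBox a c U k Ω = proj Ω ∧
      proj Ω * gBox a c U k Ω * proj Ω = gBox a c U k Ω ∧ (gBox a c U k Ω)ᴴ = gBox a c U k Ω :=
  have hN := isUnit_nPad hk hc ha U hΩ
  ⟨gBox_mul_nOp hN, nOp_mul_gBox hN, proj_mul_gBox_mul_proj hN, gBox_conjTranspose hN⟩

/-- **ON THE WHOLE TORUS** (`Ω = T^{(j)}`, no boundary) the operator is p11's `D_u^*D_u + aQ_k^*Q_k` and `G_k(T,u) = nOp^{−1}` is a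
genuine two-sided inverse (`1_T = 1`). [cite: BalabanImbrieJaffe1985, (4.6.2) p.313] -/
theorem gBox_univ_mul (hk : j + k ≤ P.m + P.K) (hc : c ≠ 0) (ha : 0 < a) (U : GaugeField P j U1) :
    gBox a c U k univ * nOp a c U k univ = 1 ∧ nOp a c U k univ * gBox a c U k univ = 1 := by
  have hN := isUnit_nPad hk hc ha U (isBlockUnion_univ k)
  have h1 : proj (univ : Finset (Balaban1983to89.Site P j)) = 1 := by
    unfold proj; rw [← diagonal_one]; congr 1; funext x; simp
  rw [← h1]
  exact ⟨gBox_mul_nOp hN, nOp_mul_gBox hN⟩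

end Inverse


/-! ## §3 (5.6.11) IN A FIXED REGION `Ω`: the resolvent identity between `G_k(Ω,u)` and `G_k(Ω,u′)`, exact -/

section Resolvent

variable {k : ℕ} {a c : ℝ} {Ω : Finset (Balaban1983to89.Site P j)}

/-- kernel: the resolvent identity for inverses ON A SUBSPACE — `G·N = 1_Ω`, `N′·G′ = 1_Ω`, `1_Ω·G′ = G′`, `G·1_Ω = G` give
`G′ = G + G(N − N′)G′` (any ring; r16's `BIJ88Sect5Statements.eq5611` is the case `1_Ω = 1`). [cite: BalabanImbrieJaffe1988, (5.6.11) p.287] -/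
theorem eq5611_of_proj {R : Type*} [Ring R] {N N' G G' Pr : R} (hG : G * N = Pr) (hG' : N' * G' = Pr) (hPG' : Pr * G' = G')
    (hGP : G * Pr = G) : G' = G + G * (N - N') * G' := by
  have h1 : G * N * G' = G' := by rw [hG, hPG']
  have h2 : G * N' * G' = G := by rw [mul_assoc, hG', hGP]
  rw [mul_sub, sub_mul, h1, h2]
  abel

/-- **(5.6.11) p. 287, verbatim: *"This leads to an expansion of the scalar field propagator in a fixed region Ω: G_j(Ω, ũ_{k+1}ũ) =
G_j(Ω, ũ_{k+1}) + G_j(Ω, ũ_{k+1})V_jG_j(Ω, ũ_{k+1}ũ). (5.6.11)"* — EXACT for the constructed Neumann propagators of ANY two `U(1)` fields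
`u`, `u′` on the same region `Ω` (a union of `k`-blocks), with `V_j(Ω) := [−Δ^N_{u,Ω} + a_kQ_k^*(u)Q_k(u)] − [−Δ^N_{u′,Ω} + a_kQ_k^*(u′)Q_k(u′)]`
((5.6.10): *"V_j(Ω) is obtained by inserting (5.6.8), (5.6.9) into the left-hand side"* = the DIFFERENCE of the two operators, r16's `Vj`;
its computed form for `u′ = ue^a` is my gen-10 `BIJ88Vj5610Operator.eq5610_matrix`).** My gen-10 `eq5611_matrix` carried the two
invertibilities `G₀·H = 1`, `H′·G = 1` on the WHOLE lattice as hypotheses (satisfiable only for `Ω = T`); here they are theorems on `ℓ²(Ω)`.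
[cite: BalabanImbrieJaffe1988, (5.6.11) p.287] -/
theorem eq5611_gBox (hk : j + k ≤ P.m + P.K) (hc : c ≠ 0) (ha : 0 < a) (hΩ : IsBlockUnion k Ω) (U U' : GaugeField P j U1) :
    gBox a c U' k Ω = gBox a c U k Ω + gBox a c U k Ω * (nOp a c U k Ω - nOp a c U' k Ω) * gBox a c U' k Ω :=
  have hN := isUnit_nPad hk hc ha U hΩ
  have hN' := isUnit_nPad hk hc ha U' hΩ
  eq5611_of_proj (gBox_mul_nOp hN) (nOp_mul_gBox hN') (proj_mul_gBox hN') gBox_mul_proj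

/-- kernel: the difference of the two Neumann operators IS r16's ring-level `V_j(Ω)` (`BIJ88Sect5StatementsPart4.Vj` with `Δ^N_{u,Ω} =
−(χ_ΩD_u)ᴴ(χ_ΩD_u)`, `P = (Q_k|_Ω)ᴴ(Q_k|_Ω)`, `a_j ↦ a·1`). [cite: BalabanImbrieJaffe1988, (5.6.10) p.287] -/
theorem nOp_sub_nOp_eq_Vj (a c : ℝ) (U U' : GaugeField P j U1) (k : ℕ) (Ω : Finset (Balaban1983to89.Site P j)) :
    nOp a c U k Ω - nOp a c U' k Ω =
      Vj ((a : ℂ) • (1 : Matrix (Balaban1983to89.Site P j) (Balaban1983to89.Site P j) ℂ))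
        (-((dN c U Ω)ᴴ * dN c U Ω)) ((qMatK U k Ω)ᴴ * qMatK U k Ω)
        (-((dN c U' Ω)ᴴ * dN c U' Ω)) ((qMatK U' k Ω)ᴴ * qMatK U' k Ω) := by
  simp only [Vj, nOp_eq, neg_neg, smul_mul_assoc, Matrix.one_mul]

/-- **(5.6.12) WITHOUT the kernel `w₆` in a fixed region `Ω`, every order `n̄`**, p. 288 verbatim: *"This is now iterated to yield
G_{j,loc}(ũ_{k+1}ũ) = Σ_{n=0}^{n̄} G_{j,loc}(ũ_{k+1})[V_jG_{j,loc}(ũ_{k+1})]ⁿ + G_{j,loc}(ũ_{k+1})[V_jG_{j,loc}(ũ_{k+1})]^{n̄}V_jG_{j,loc}(ũ_{k+1}ũ) + w₆"*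
— for the region propagators `G_k(Ω,·)` themselves the iteration is EXACT (no `w₆`): the (5.6.11) above fed BY NAME into my gen-10
`BIJ88Eq5612W6.eq5612_w6_zero_defect`. [cite: BalabanImbrieJaffe1988, (5.6.12) p.288] -/
theorem eq5612_gBox (hk : j + k ≤ P.m + P.K) (hc : c ≠ 0) (ha : 0 < a) (hΩ : IsBlockUnion k Ω) (U U' : GaugeField P j U1) (N : ℕ) :
    gBox a c U' k Ω =
      (∑ n ∈ Finset.range (N + 1), gBox a c U k Ω * ((nOp a c U k Ω - nOp a c U' k Ω) * gBox a c U k Ω) ^ n)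
        + gBox a c U k Ω * ((nOp a c U k Ω - nOp a c U' k Ω) * gBox a c U k Ω) ^ N * (nOp a c U k Ω - nOp a c U' k Ω)
          * gBox a c U' k Ω :=
  BIJ88Eq5612W6.eq5612_w6_zero_defect (eq5611_gBox hk hc ha hΩ U U') N

end Resolvent

end

end Literature.MathematicalPhysics.QuantumFieldTheory.BalabanImbrieJaffe1984to88.BIJ88NeumannPropagator227Torus
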